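import Summits.ValiantsHypothesis.ValiantsHypothesis.Theorems.FeketeSOSFeketeSOSHardPaleyRIPLowRankSquares

/-!
# Route FeketeSOS — crux `FeketeSOSHard` (stmt-ValiantsHypothesis-3996), line `paley-rip` v3,
# `stub_tameOperator` toolkit: complex SYMMETRIC matrices are carried by squares at cost `√n · ‖·‖_F`
# (no Takagi), squares vocabulary, Gram expansion, cyclic fibre sums

Piece 1 of the kernel form of certificate P3′ (ℓ²-spreading with multiplicities; census
`Cruxes/FeketeSOSHard/Lines/paley-rip-stub3-census.md` §8, there "needs Takagi for complex patterns").  The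
sequel `…PaleyRIPSpreadL2.lean` applies it to the multiplicity-spread preimage `τ″_{st} = F_{s+t}/r_S(s+t)`.

* `sym_nuclear_le_sqrt_card` — for a symmetric `M : ι × ι → ℂ` there are weights `λ_j` and vectors `g_j` with
  `Σ_j λ_j g_j g_jᵀ = M` and `Σ_j |λ_j|‖g_j‖² ≤ √#ι · ‖M‖_F`, WITHOUT Takagi's factorisation:
  `M = Σ_σ ½ (m_σ e_σᵀ + e_σ m_σᵀ)` (`m_σ` = the `σ`-th column, `e_σ` the unit vector), each summand is the
  balanced polarisation `(1/4s)[(m + s e)(m + s e)ᵀ − (m − s e)(m − s e)ᵀ]`, `s = ‖m‖`, of cost exactly `‖m_σ‖`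
  (`polar_entry`, `polar_mass` of `…PaleyRIPSymOuterNuclear.lean`), and `Σ_σ ‖m_σ‖ ≤ √n ‖M‖_F` (Cauchy–Schwarz).
  (Compare `symOuter_nuclear_le` there: `√rank` for tensors GIVEN as `Σ_{i<r} c_i v_i v_iᵀ`; here the input is
  an arbitrary symmetric matrix and the constant is `√n`.)
* `symMatrix_rep` — squares vocabulary: a symmetric coefficient tensor `T` on `D × D` is the Gram tensor
  `Σ_j c'_j g_j(a) g_j(b)` of weighted squares supported in `D` with `Σ_j |c'_j|‖g_j‖₂² ≤ √#D (Σ_{a,b∈D}|T(a,b)|²)^{1/2}`.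
* `sum_sq_eq_gram_sum` — `Σ_j c'_j g_j² = Σ_{a,b∈D} (Σ_j c'_j g_j(a) g_j(b)) X^{a+b}`.
* `sum_sum_eq_sum_fibres` — `Σ_{a,b∈S} f(a,b)` summed by the fibres of `(a,b) ↦ (a+b) mod p`.

Honest framing (rung currency): a Theorems-side helper `--supports` stmt-3996; nothing here closes a registered
stub; `stub_tameOperator`, the engine `stub_paleyFlatRIP` and the crux stay OPEN; `VP ≠ VNP` is untouched.
-/

set_option linter.dupNamespace false

namespace Summit.ValiantsHypothesis.ValiantsHypothesis.Theorems.FeketeSOSHardPaleyRIP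

open Polynomial Finset
open scoped BigOperators

noncomputable section

/-! ## A. Symmetric matrices are cheap: nuclear `≤ √n ·` Frobenius, without Takagi -/

/-- **Complex symmetric matrices are carried by squares at cost `√n · ‖·‖_F` (no Takagi).**  For a symmetric
`M : ι × ι → ℂ` on a finite index set there are weights `λ_j` and vectors `g_j` with
`Σ_j λ_j g_j(a) g_j(b) = M(a,b)` for all `a, b` and `Σ_j |λ_j| Σ_a |g_j(a)|² ≤ √#ι · (Σ_{a,b} |M(a,b)|²)^{1/2}`
(column-wise balanced polarisation `M = Σ_σ ½(m_σ e_σᵀ + e_σ m_σᵀ)`, cost `Σ_σ ‖m_σ‖ ≤ √n ‖M‖_F`). [folklore] -/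
theorem sym_nuclear_le_sqrt_card {ι : Type*} [Fintype ι] [DecidableEq ι] (M : ι → ι → ℂ)
    (hM : ∀ a b, M a b = M b a) :
    ∃ (s : ℕ) (lam : Fin s → ℂ) (g : Fin s → ι → ℂ),
      (∀ a b, ∑ j, lam j * (g j a * g j b) = M a b) ∧
      (∑ j, ‖lam j‖ * ∑ a, ‖g j a‖ ^ 2) ≤
        Real.sqrt (Fintype.card ι) * Real.sqrt (∑ a, ∑ b, ‖M a b‖ ^ 2) := by
  classical
  set q : ℕ := Fintype.card ι with hqdef
  let σ : Fin q ≃ ι := (Fintype.equivFin ι).symm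
  -- the columns of `M` and the unit vectors, as elements of `ℂ^ι`
  let u : Fin q → EuclideanSpace ℂ ι := fun k => WithLp.toLp 2 (fun α => M α (σ k))
  let e : Fin q → EuclideanSpace ℂ ι := fun k => EuclideanSpace.single (σ k) (1 : ℂ)
  have hu : ∀ k α, u k α = M α (σ k) := fun k α => rfl
  have he : ∀ k α, e k α = if α = σ k then 1 else 0 := fun k α => by
    simp only [e, PiLp.single_apply]
  have he1 : ∀ k, ‖e k‖ = 1 := fun k => by
    simp only [e, PiLp.norm_single, norm_one]
  -- `M(a,b) = Σ_k u_k(a) e_k(b) = Σ_k e_k(a) u_k(b)`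
  have hC1 : ∀ a b, M a b = ∑ k, u k a * e k b := by
    intro a b
    rw [Finset.sum_eq_single (σ.symm b)]
    · rw [hu, he, Equiv.apply_symm_apply, if_pos rfl, mul_one]
    · intro k _ hk
      have hb : b ≠ σ k := fun h => hk (by rw [h, Equiv.symm_apply_apply])
      rw [he, if_neg hb, mul_zero]
    · intro h; exact absurd (Finset.mem_univ _) h
  have hC2 : ∀ a b, M a b = ∑ k, e k a * u k b := by
    intro a b
    rw [hM a b, hC1 b a]
    exact Finset.sum_congr rfl fun k _ => mul_comm _ _
  -- the family: for each column the two polarised vectors `u_k ± ‖u_k‖ e_k`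
  let lamP : Fin q → ℂ := fun k => (4 * (‖u k‖ : ℂ))⁻¹
  let gP : Fin q → EuclideanSpace ℂ ι := fun k => u k + (‖u k‖ : ℂ) • e k
  let gM : Fin q → EuclideanSpace ℂ ι := fun k => u k - (‖u k‖ : ℂ) • e k
  refine ⟨q + q, Fin.append lamP (fun k => -lamP k),
    Fin.append (fun k => WithLp.ofLp (gP k)) (fun k => WithLp.ofLp (gM k)), ?_, ?_⟩
  · intro a b
    rw [Fin.sum_univ_add (M := ℂ)]
    simp only [Fin.append_left, Fin.append_right]
    rw [← Finset.sum_add_distrib,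
      Finset.sum_congr rfl fun k _ => polar_entry (u k) (e k) a b, ← Finset.mul_sum,
      Finset.sum_add_distrib, ← hC1 a b, ← hC2 a b]
    ring
  · rw [Fin.sum_univ_add (M := ℝ)]
    simp only [Fin.append_left, Fin.append_right]
    have hnorm : ∀ (w : EuclideanSpace ℂ ι), ∑ a, ‖w a‖ ^ 2 = ‖w‖ ^ 2 := fun w =>
      (EuclideanSpace.norm_sq_eq w).symm
    simp_rw [hnorm]
    rw [← Finset.sum_add_distrib, Finset.sum_congr rfl fun k _ => polar_mass (u k) (e k) (he1 k)]
    refine (sum_le_sqrt_card_mul_sqrt_sum_sq q (fun k => ‖u k‖) fun k => norm_nonneg _).trans ?_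
    refine mul_le_mul_of_nonneg_left (Real.sqrt_le_sqrt (le_of_eq ?_)) (Real.sqrt_nonneg _)
    calc ∑ k, ‖u k‖ ^ 2 = ∑ k, ∑ α, ‖u k α‖ ^ 2 := Finset.sum_congr rfl fun k _ => (hnorm (u k)).symm
      _ = ∑ k, ∑ α, ‖M α (σ k)‖ ^ 2 := rfl
      _ = ∑ b, ∑ α, ‖M α b‖ ^ 2 :=
          Fintype.sum_equiv σ (fun k => ∑ α, ‖M α (σ k)‖ ^ 2) (fun b => ∑ α, ‖M α b‖ ^ 2) fun k => rfl
      _ = ∑ a, ∑ b, ‖M a b‖ ^ 2 := Finset.sum_comm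


/-! ## B. Squares vocabulary -/

/-- **Symmetric coefficient tensors on `D` are carried by squares supported in `D` at cost
`√#D · Frobenius`.**  For `T : ℕ × ℕ → ℂ` symmetric there are weighted squares `(c'_j, g_j)` with
`supp g_j ⊆ D`, Gram tensor `Σ_j c'_j g_j(a) g_j(b) = T(a,b)` on `D × D` (and `0` off `D × D`), and
`Σ_j |c'_j|‖g_j‖₂² ≤ √#D · (Σ_{a,b∈D} |T(a,b)|²)^{1/2}`. [folklore] -/
theorem symMatrix_rep (D : Finset ℕ) (T : ℕ → ℕ → ℂ) (hT : ∀ a b, T a b = T b a) :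
    ∃ (s : ℕ) (c' : Fin s → ℂ) (g : Fin s → ℂ[X]), (∀ j, (g j).support ⊆ D) ∧
      (∀ a b, ∑ j, c' j * ((g j).coeff a * (g j).coeff b) = if a ∈ D ∧ b ∈ D then T a b else 0) ∧
      (∑ j, sqMass (c' j) (g j)) ≤ Real.sqrt D.card * Real.sqrt (∑ a ∈ D, ∑ b ∈ D, ‖T a b‖ ^ 2) := by
  classical
  obtain ⟨s, lam, g, hId, hMass⟩ :=
    sym_nuclear_le_sqrt_card (ι := ↥D) (fun a b => T (a : ℕ) (b : ℕ)) (fun a b => hT a b)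
  -- back to polynomials: extend the vectors by zero off `D`
  let gN : Fin s → ℕ → ℂ := fun j n => if h : n ∈ D then g j ⟨n, h⟩ else 0
  have hgN : ∀ j (d : ↥D), gN j (d : ℕ) = g j d := fun j d => by
    simp only [gN, dif_pos d.2]
  let G : Fin s → ℂ[X] := fun j => ∑ d ∈ D, C (gN j d) * (X : ℂ[X]) ^ d
  have hGcoeff : ∀ j n, (G j).coeff n = gN j n := by
    intro j n
    rw [coeff_sum_C_mul_X_pow]
    by_cases hn : n ∈ D
    · rw [if_pos hn]
    · rw [if_neg hn]; simp only [gN, dif_neg hn]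
  refine ⟨s, lam, G, fun j => support_sum_C_mul_X_pow_subset D (gN j), ?_, ?_⟩
  · intro a b
    by_cases ha : a ∈ D
    · by_cases hb : b ∈ D
      · have h := hId ⟨a, ha⟩ ⟨b, hb⟩
        simp only [hGcoeff, ← hgN] at h ⊢
        rw [if_pos ⟨ha, hb⟩]
        exact h
      · rw [if_neg fun h => hb h.2]
        simp only [hGcoeff, gN, dif_neg hb, mul_zero, Finset.sum_const_zero]
    · rw [if_neg fun h => ha h.1]
      simp only [hGcoeff, gN, dif_neg ha, zero_mul, mul_zero, Finset.sum_const_zero]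
  · have hm : ∀ j, sqMass (lam j) (G j) = ‖lam j‖ * ∑ d : ↥D, ‖g j d‖ ^ 2 := by
      intro j
      rw [sqMass_sum_C_mul_X_pow, ← Finset.sum_coe_sort D]
      simp only [hgN]
    have hF : (∑ a ∈ D, ∑ b ∈ D, ‖T a b‖ ^ 2) = ∑ a : ↥D, ∑ b : ↥D, ‖T (a : ℕ) (b : ℕ)‖ ^ 2 := by
      rw [← Finset.sum_coe_sort D]
      exact Finset.sum_congr rfl fun a _ => by rw [← Finset.sum_coe_sort D]
    rw [Finset.sum_congr rfl fun j _ => hm j, hF, ← Fintype.card_coe D]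
    exact hMass

/-- The pattern of weighted squares supported in `D` from their Gram tensor:
`Σ_j c'_j g_j² = Σ_{a,b∈D} (Σ_j c'_j g_j(a) g_j(b)) X^{a+b}`. [folklore] -/
theorem sum_sq_eq_gram_sum (D : Finset ℕ) {s : ℕ} (c' : Fin s → ℂ) (g : Fin s → ℂ[X])
    (hg : ∀ j, (g j).support ⊆ D) :
    (∑ j, C (c' j) * g j ^ 2) =
      ∑ a ∈ D, ∑ b ∈ D, C (∑ j, c' j * ((g j).coeff a * (g j).coeff b)) * X ^ (a + b) := by
  have hexp : ∀ j, g j = ∑ a ∈ D, C ((g j).coeff a) * X ^ a := fun j => by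
    conv_lhs => rw [as_sum_support_C_mul_X_pow (g j)]
    refine Finset.sum_subset (hg j) fun a _ ha => ?_
    rw [notMem_support_iff.1 ha, map_zero, zero_mul]
  have hsq : ∀ j, C (c' j) * g j ^ 2 =
      ∑ a ∈ D, ∑ b ∈ D, C (c' j * ((g j).coeff a * (g j).coeff b)) * X ^ (a + b) := by
    intro j
    rw [pow_two]
    conv_lhs => rw [hexp j]
    rw [Finset.sum_mul_sum, Finset.mul_sum]
    refine Finset.sum_congr rfl fun a _ => ?_
    rw [Finset.mul_sum]
    refine Finset.sum_congr rfl fun b _ => ?_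
    simp only [map_mul, pow_add]
    ring
  rw [Finset.sum_congr rfl fun j _ => hsq j, Finset.sum_comm]
  refine Finset.sum_congr rfl fun a _ => ?_
  rw [Finset.sum_comm]
  refine Finset.sum_congr rfl fun b _ => ?_
  rw [← Finset.sum_mul, ← map_sum]

/-- Summing over `S × S` by the fibres of `(s,t) ↦ (s + t) mod p`. [folklore] -/
theorem sum_sum_eq_sum_fibres (S : Finset ℕ) (p : ℕ) {β : Type*} [AddCommMonoid β] (f : ℕ × ℕ → β) :
    ∑ a ∈ S, ∑ b ∈ S, f (a, b) =
      ∑ ν ∈ (S ×ˢ S).image (fun st : ℕ × ℕ => (st.1 + st.2) % p),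
        ∑ st ∈ (S ×ˢ S).filter (fun st : ℕ × ℕ => (st.1 + st.2) % p = ν), f st := by
  classical
  rw [← Finset.sum_product (f := f)]
  exact (Finset.sum_fiberwise_of_maps_to (fun st hst => Finset.mem_image_of_mem _ hst) f).symm

end

end Summit.ValiantsHypothesis.ValiantsHypothesis.Theorems.FeketeSOSHardPaleyRIP
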